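import Mathlib.RingTheory.Kaehler.Basic
import Mathlib.RingTheory.LocalRing.ResidueField.Basic
import Mathlib.RingTheory.LocalRing.RingHom.Basic
import Mathlib.LinearAlgebra.Determinant
import HarnessLib

/-!
# Two residue computations at a rational point: a local algebra endomorphism fixes residues, and a Jacobian
# matrix congruent to the identity modulo `𝔪` has determinant of residue `1`

Topic `Literature/RingTheory/Derivation`, namespace `Literature.RingTheory.Derivation`.  THEOREMS ONLY (no definition,
no named fact, no instance, no `sorry`; Mathlib-only imports).  Cell `hodgecm-mathlib` (D-0151), road W toward `r₀`,
(W0) «the group law of `A_K` is an `R`-birational group law on a smooth proper model» (B-p18's W0-CORE-SPEC §4,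
leaf L4c′ «the shear cocycle is a unit at the `K`-point `z = (ε, ε)`», pins PIN-1 and PIN-2a): the residue of the cocycle
germ `t = Φ♯_z(t_u) · det(Jacobian) · t_u⁻¹` is `1` because (PIN-2a) the local `K`-algebra endomorphism `Φ♯_z` of
`𝒪_{Y,z}` does not change residues at a `K`-rational point and (PIN-1) the relative Jacobian matrix of `μ` at `(ε, ε)` in
adapted coordinates is `≡ 1 (mod 𝔪_z)`.  Both are the elementary commutative algebra behind «`Φ^*(pr₂^*θ) = pr₂^*θ` at the
origin» in the `ω`-argument ([EdixhovenRomagny] proof of Thm. 6.3; [BLRNeronModels1990] §4.3).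

* §1 `residue_map_eq_residue` — `O` a local `K`-algebra with `K → κ(O)` surjective (a `K`-rational point), `φ : O →ₐ[K] O`
  a LOCAL `K`-algebra map ⇒ `residue (φ g) = residue g` for all `g`.
* §2 `repr_mem_of_mem_smul_top` — coordinates of an element of `I • ⊤` in a basis lie in `I`;
  **`residue_det_eq_one`** — for a basis `b` of `Ω[O⁄A]` with `b i = d(w i)` and elements `v i` with
  `d(v i) - d(w i) ∈ 𝔪 • Ω[O⁄A]`, `residue (b.det (d ∘ v)) = 1`.
* §3 `smul_mkQ_eq_of_residue_eq`; `residue_map_section_eq` (`p ∘ s` fixes residues when `s ∘ p = id`);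
  **`sub_mem_maximalIdeal_smul_top_of_section`** (PIN-2b core, «`δ = δ_E`»): for ring
  maps `p μ : O' → O` with a common retraction `s` such that `d(p s a) ∈ 𝔪 • Ω` for `A`-scalars `a`, and a basis `d(p wᵢ)` of `Ω[O⁄A]`: `d(μ g) - d(p g) ∈ 𝔪 • Ω[O⁄A]` for all `g`;
  **`residue_det_eq_one_of_section`** — hence `residue (b.det (d ∘ μ ∘ z)) = 1` when `b i = d(p zᵢ)`.

HC_CM is proved only modulo the 7 printed citations until rung 0 closes; banked leaf (no floor change).

## References
* [EdixhovenRomagny] B. Edixhoven, M. Romagny, arXiv:1204.1799v2, §6, proof of Thm. 6.3 (the `ω`-argument).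
* [BLRNeronModels1990] S. Bosch, W. Lütkebohmert, M. Raynaud, *Néron Models* (1990), §4.3 (numbers only; not held).
-/

namespace Literature.RingTheory.Derivation

open IsLocalRing

/-! ## §1 PIN-2a: a local `K`-algebra endomorphism at a `K`-rational point fixes residues -/

/-- **A local `K`-algebra endomorphism does not change residues at a `K`-rational point**: if `O` is a local
`K`-algebra whose residue field is generated by `K` (`algebraMap K κ(O)` surjective) and `φ : O →ₐ[K] O` is a local
homomorphism, then `residue (φ g) = residue g` — write `g = k + m` with `k ∈ K`, `m ∈ 𝔪`; `φ` fixes `k` and keeps `m` in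
`𝔪`.  (Used in the `ω`-argument for the pull-back `Φ♯_z` by the shear `Φ = (pr₁, μ)` at the point `z = (ε, ε)`, which is
over `Spec K` and rational.) [cite: EdixhovenRomagny, proof of Thm. 6.3] -/
theorem residue_map_eq_residue {K O : Type*} [Field K] [CommRing O] [IsLocalRing O] [Algebra K O]
    (hK : Function.Surjective (algebraMap K (ResidueField O)))
    (φ : O →ₐ[K] O) [IsLocalHom (φ : O →+* O)] (g : O) :
    residue O (φ g) = residue O g := by
  obtain ⟨k, hk⟩ := hK (residue O g)
  have hk' : residue O (algebraMap K O k) = residue O g := by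
    rw [← hk, IsScalarTower.algebraMap_apply K O (ResidueField O)]; rfl
  have hmem : g - algebraMap K O k ∈ maximalIdeal O := by
    rw [← Ideal.Quotient.eq_zero_iff_mem]
    change residue O (g - algebraMap K O k) = 0
    rw [map_sub, hk', sub_self]
  have hφmem : φ (g - algebraMap K O k) ∈ maximalIdeal O := map_nonunit (φ : O →+* O) _ hmem
  have hdecomp : φ g = φ (g - algebraMap K O k) + algebraMap K O k := by
    rw [map_sub, AlgHom.commutes, sub_add_cancel]
  rw [hdecomp, map_add, hk']
  have h0 : residue O (φ (g - algebraMap K O k)) = 0 := by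
    change Ideal.Quotient.mk _ _ = 0
    exact Ideal.Quotient.eq_zero_iff_mem.mpr hφmem
  rw [h0, zero_add]

/-! ## §2 PIN-1: a Jacobian matrix `≡ 1 (mod 𝔪)` has determinant of residue `1` -/

/-- Coordinates, in a basis, of an element of `I • M` lie in `I`. [cite: EdixhovenRomagny, proof of Thm. 6.3] -/
theorem repr_mem_of_mem_smul_top {R M ι : Type*} [CommRing R] [AddCommGroup M] [Module R M] (b : Module.Basis ι R M)
    (I : Ideal R) {m : M} (hm : m ∈ I • (⊤ : Submodule R M)) (j : ι) : b.repr m j ∈ I := by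
  refine Submodule.smul_induction_on hm (fun a ha y _ => ?_) (fun x y hx hy => ?_)
  · rw [map_smul, Finsupp.smul_apply, smul_eq_mul]
    exact I.mul_mem_right _ ha
  · rw [map_add, Finsupp.add_apply]
    exact I.add_mem hx hy

/-- **The determinant of a Jacobian matrix congruent to the identity modulo `𝔪` has residue `1`.**  Let `O` be a
local `A`-algebra, `b` a basis of `Ω[O⁄A]` indexed by `Fin n` with `b i = d(w i)`, and `v i` elements with
`d(v i) - d(w i) ∈ 𝔪 • Ω[O⁄A]`.  Then the matrix of the `d(v i)` in the basis `b` is `1 + (entries in 𝔪)`, so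
`residue (b.det (fun i => d (v i))) = det 1 = 1`.  (In the `ω`-argument: `w` = coordinates `pr₂♯ zε` at `z = (ε, ε)`,
`v` = `μ♯ zε`, and the congruence is «`i♯ ∘ μ♯ = i♯ ∘ pr₂♯` on the slice `x ↦ (ε, x)`».)
[cite: EdixhovenRomagny, proof of Thm. 6.3] -/
theorem residue_det_eq_one {A O : Type*} [CommRing A] [CommRing O] [Algebra A O] [IsLocalRing O] {n : ℕ}
    (b : Module.Basis (Fin n) O (Ω[O⁄A])) (w v : Fin n → O) (hb : ∀ i, b i = KaehlerDifferential.D A O (w i))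
    (h : ∀ i, KaehlerDifferential.D A O (v i) - KaehlerDifferential.D A O (w i) ∈
      (maximalIdeal O) • (⊤ : Submodule O (Ω[O⁄A]))) :
    residue O (b.det fun i => KaehlerDifferential.D A O (v i)) = 1 := by
  -- the entries of the matrix of `d(v i)` in the basis `b`, reduced modulo `𝔪`
  have hentry : ∀ i j, residue O (b.repr (KaehlerDifferential.D A O (v j)) i) = (1 : Matrix (Fin n) (Fin n) _) i j := by
    intro i j
    have hsplit : KaehlerDifferential.D A O (v j) =
        b j + (KaehlerDifferential.D A O (v j) - KaehlerDifferential.D A O (w j)) := by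
      rw [hb j, add_sub_cancel]
    rw [hsplit, map_add, Finsupp.add_apply, Module.Basis.repr_self, map_add]
    have hm : residue O (b.repr (KaehlerDifferential.D A O (v j) - KaehlerDifferential.D A O (w j)) i) = 0 := by
      change Ideal.Quotient.mk _ _ = 0
      exact Ideal.Quotient.eq_zero_iff_mem.mpr (repr_mem_of_mem_smul_top b _ (h j) i)
    rw [hm, add_zero, Finsupp.single_apply, Matrix.one_apply]
    by_cases hij : i = j
    · subst hij; simp
    · rw [if_neg (Ne.symm hij), if_neg hij, map_zero]
  rw [Module.Basis.det_apply, RingHom.map_det]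
  have hM : (residue O).mapMatrix (b.toMatrix fun i => KaehlerDifferential.D A O (v i)) = 1 := by
    ext i j
    rw [RingHom.mapMatrix_apply, Matrix.map_apply, Module.Basis.toMatrix_apply]
    exact hentry i j
  rw [hM, Matrix.det_one]


/-! ## §3 PIN-2b (abstract): `d(μ♯ g) ≡ d(pr₂♯ g) (mod 𝔪)` along a section, hence residue of the Jacobian `= 1` -/

/-- In the reduction `M ⧸ 𝔪 • M` of a module over a local ring, the scalar action of `f` only depends on the residue
of `f`. [cite: EdixhovenRomagny, proof of Thm. 6.3] -/
theorem smul_mkQ_eq_of_residue_eq {O M : Type*} [CommRing O] [IsLocalRing O] [AddCommGroup M] [Module O M]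
    {f f' : O} (h : residue O f = residue O f') (m : M ⧸ (maximalIdeal O) • (⊤ : Submodule O M)) :
    f • m = f' • m := by
  obtain ⟨ω, rfl⟩ := Submodule.mkQ_surjective _ m
  rw [← sub_eq_zero, ← sub_smul, ← map_smul, Submodule.mkQ_apply, Submodule.Quotient.mk_eq_zero]
  refine Submodule.smul_mem_smul ?_ Submodule.mem_top
  rw [← residue_eq_zero_iff, map_sub, h, sub_self]

/-- A ring endomorphism of a local ring of the form `p ∘ s` with `s ∘ p = id` (`O'` nontrivial) fixes residues:
`f - p (s f)` lies in the kernel of `s`, hence is not a unit.  (Geometry: `p = pr₂♯`, `s = i♯` for a section `i`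
of `pr₂` through the point.) [cite: EdixhovenRomagny, proof of Thm. 6.3] -/
theorem residue_map_section_eq {O O' : Type*} [CommRing O] [IsLocalRing O] [CommRing O'] [Nontrivial O']
    (p : O' →+* O) (s : O →+* O') (hsp : ∀ g, s (p g) = g) (f : O) :
    residue O (p (s f)) = residue O f := by
  rw [← sub_eq_zero, ← map_sub, residue_eq_zero_iff]
  by_contra hu
  have hunit : IsUnit (p (s f) - f) := not_not.1 fun h' => hu ((mem_maximalIdeal _).2 h')
  have h0 : IsUnit (s (p (s f) - f)) := hunit.map s
  rw [map_sub, hsp, sub_self] at h0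
  exact not_isUnit_zero h0

/-- **The `1`-jets of `μ♯` and `pr₂♯` agree at a point of a section** (the «`δ = δ_E`» step of the `ω`-argument,
made abstract).  Let `O` be a local `A`-algebra, `p μ : O' → O` two ring maps with a common retraction `s : O → O'`
(`s ∘ p = id = s ∘ μ`, so that the endomorphism `p ∘ s` of `O` fixes residues, `residue_map_section_eq`) sending
`A`-scalars to elements with differential in `𝔪 • Ω[O⁄A]`, and suppose `Ω[O⁄A]` has a basis of differentials `d(p wᵢ)`.  Then for every
`g ∈ O'`, `d(μ g) ≡ d(p g) (mod 𝔪 • Ω[O⁄A])`.  (Geometry: `O = 𝒪_{E × E, (ε,ε)}`, `O' = 𝒪_{E,ε}`, `p = pr₂♯`,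
`μ = μ♯`, `s = i♯` for the slice `i : x ↦ (ε, x)`, `A = Γ(E, V₁)` acting through `pr₁♯`.)
[cite: EdixhovenRomagny, proof of Thm. 6.3] -/
theorem sub_mem_maximalIdeal_smul_top_of_section {A O O' : Type*} [CommRing A] [CommRing O] [IsLocalRing O]
    [CommRing O'] [Nontrivial O'] [Algebra A O] (p μ : O' →+* O) (s : O →+* O') (hsp : ∀ g, s (p g) = g)
    (hsμ : ∀ g, s (μ g) = g)
    (hA : ∀ a, KaehlerDifferential.D A O (p (s (algebraMap A O a))) ∈
      (maximalIdeal O) • (⊤ : Submodule O Ω[O⁄A]))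
    {ι : Type*} (b : Module.Basis ι O Ω[O⁄A]) (w : ι → O')
    (hb : ∀ i, b i = KaehlerDifferential.D A O (p (w i))) (g : O') :
    KaehlerDifferential.D A O (μ g) - KaehlerDifferential.D A O (p g) ∈
      (maximalIdeal O) • (⊤ : Submodule O Ω[O⁄A]) := by
  -- `p ∘ s` fixes residues: `f - p (s f) ∈ ker s ⊆ 𝔪`
  have hres : ∀ f, residue O (p (s f)) = residue O f := residue_map_section_eq p s hsp
  -- the reduction `M := Ω ⧸ 𝔪 • Ω` and the reduced universal derivation `δ`
  set N : Submodule O Ω[O⁄A] := (maximalIdeal O) • ⊤ with hN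
  let δ : Derivation A O (Ω[O⁄A] ⧸ N) := (N.mkQ).compDer (KaehlerDifferential.D A O)
  have hδ : ∀ f, δ f = N.mkQ (KaehlerDifferential.D A O f) := fun f => rfl
  -- the twisted derivation `δ_E := δ ∘ p ∘ s`
  have hsm : ∀ (f : O) (m : Ω[O⁄A] ⧸ N), p (s f) • m = f • m := fun f m =>
    smul_mkQ_eq_of_residue_eq (hres f) m
  have hA0 : ∀ a, δ (p (s (algebraMap A O a))) = 0 := fun a => by
    rw [hδ, Submodule.mkQ_apply, Submodule.Quotient.mk_eq_zero]
    exact hA a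
  have hleib : ∀ f f' : O, δ (p (s (f * f'))) = f • δ (p (s f')) + f' • δ (p (s f)) := fun f f' => by
    rw [map_mul, map_mul, Derivation.leibniz, hsm, hsm]
  let L : O →ₗ[A] (Ω[O⁄A] ⧸ N) :=
    { toFun := fun f => δ (p (s f))
      map_add' := fun f f' => by simp only [map_add]
      map_smul' := fun a f => by
        rw [RingHom.id_apply, Algebra.smul_def, hleib, hA0, smul_zero, add_zero, algebraMap_smul] }
  let δE : Derivation A O (Ω[O⁄A] ⧸ N) := Derivation.mk' L fun f f' => hleib f f'
  have hδE : ∀ f, δE f = δ (p (s f)) := fun f => rfl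
  -- both factor through `Ω[O⁄A]` and agree on the basis `d(p wᵢ)`
  have hlift : δE.liftKaehlerDifferential = δ.liftKaehlerDifferential := by
    refine b.ext fun i => ?_
    rw [hb i, Derivation.liftKaehlerDifferential_comp_D, Derivation.liftKaehlerDifferential_comp_D, hδE, hsp]
  have heq : ∀ f, δE f = δ f := fun f => by
    rw [← Derivation.liftKaehlerDifferential_comp_D, hlift, Derivation.liftKaehlerDifferential_comp_D]
  -- evaluate at `μ g`
  have key : δ (μ g) = δ (p g) := by
    rw [← heq, hδE, hsμ]
  rw [hδ, hδ, Submodule.mkQ_apply, Submodule.mkQ_apply, Submodule.Quotient.eq] at key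
  exact key


/-- **PIN-2b (abstract `E`-side form): the relative Jacobian of `μ` at a point of the slice has residue `1`.**
In the situation of `sub_mem_maximalIdeal_smul_top_of_section`, if `d(p zᵢ)` is a basis of `Ω[O⁄A]` then the
determinant of `(d(μ zᵢ))ᵢ` in that basis has residue `1`: combine it with `residue_det_eq_one`.
(Geometry: `z i` = germs at `ε` of chart coordinates of `E`, basis from the product chart at `(ε, ε)`.)
[cite: EdixhovenRomagny, proof of Thm. 6.3] -/
theorem residue_det_eq_one_of_section {A O O' : Type*} [CommRing A] [CommRing O] [IsLocalRing O]
    [CommRing O'] [Nontrivial O'] [Algebra A O] (p μ : O' →+* O) (s : O →+* O') (hsp : ∀ g, s (p g) = g)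
    (hsμ : ∀ g, s (μ g) = g)
    (hA : ∀ a, KaehlerDifferential.D A O (p (s (algebraMap A O a))) ∈
      (maximalIdeal O) • (⊤ : Submodule O Ω[O⁄A]))
    {n : ℕ} (z : Fin n → O') (b : Module.Basis (Fin n) O Ω[O⁄A])
    (hb : ∀ i, b i = KaehlerDifferential.D A O (p (z i))) :
    residue O (b.det fun i => KaehlerDifferential.D A O (μ (z i))) = 1 :=
  residue_det_eq_one b (fun i => p (z i)) (fun i => μ (z i)) hb fun i =>
    sub_mem_maximalIdeal_smul_top_of_section p μ s hsp hsμ hA b z hb (z i)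

end Literature.RingTheory.Derivation
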